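import Literature.MeasureTheory.Group.OrbitalDescentWeilStep
import Literature.MeasureTheory.Group.OrbitalDescentFubini
import Literature.MeasureTheory.Group.InvariantQuotientNormalized
import Literature.MeasureTheory.Group.ConjClassClosedEmbedding
import Literature.NumberTheory.Automorphic.LocalOrbitalIntegral
import HarnessLib

/-!
# Harish-Chandra's descent of orbital integrals to a subgroup containing the centraliser: `Φ^G(t, ψ) = Φ^M(t, ψ_M)`

Topic `MeasureTheory/Group`; namespace `Literature.MeasureTheory.Group` (continues ★ `ConjugationCutoff` (M1), ★ `OrbitalDescentFunction` (M2a),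
★ `OrbitalDescentWeilStep` (M2b-α), ★ `OrbitalDescentFubini` (M2b-γ) of F0P3a-p08).  THEOREMS ONLY (no definition, no named fact, no instance,
no notation, no `sorry`).  GENERIC measure theory on a locally compact second countable group `G`.

DATA.  `ν` a Haar measure on `G` (left- and right-invariant), `M ≤ G` closed with a right- and inversion-invariant Haar measure `νM`, `t ∈ M`,
`T = Z_G(t)` and `T′ = Z_M(t)` closed with inversion-invariant Haar measures `νT`, `νT′` matched along the inclusion `T′ → T`
(`hνT : νT = map incl νT′`), the CANONICAL quotient measures `ν∕νT` on `G ⧸ T` and `νM∕νT′` on `M ⧸ T′` (★ `quotientMeasure`, unfolding constant `1`,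
★ `unfoldingConstant_quotientMeasure`); a cut-off `β ∈ C_c(G)`, `β ≥ 0`, with `∫_M β(c k₀ k) dνM(k) = 1` for `c ∈ C`, `k₀ ∈ M` (★ M1
`exists_continuous_hasCompactSupport_integral_comp_mul_eq_one`); `ψ ∈ C_c(G)`; and the «compact modulo `M`» hypothesis at `t`:
`y t y⁻¹ ∈ tsupport ψ ⇒ y ∈ C·M`.

**`orbitalIntegral_eq_orbitalIntegral_descended`: `Φ^G(t, ψ; ν∕νT) = Φ^M(t, ψ_M; νM∕νT′)` with `ψ_M(m) = ∫_G β(x) • ψ(x m x⁻¹) dν(x)`**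
[HarishChandra1970, Part I §3, Lemmas 22–23; LanglandsShelstad1990Descent §2.4; Rogawski1990 §8.2 p. 113].

Proof.  `Φ^M(t, ψ_M) = ∫_{M⧸T′} ψ_M(k t k⁻¹) dk̇`; `ψ_M(k t k⁻¹) = ∫_G β(x k⁻¹) ψ(x t x⁻¹) dν` (★ α1); Weil on `G ⊇ T` with constant `1` (★ α3) turns it
into `∫_{G⧸T} A(ẏ, k̇) F(ẏ) d(ν∕νT)` with `F = ψ̃ = descConj t T ψ` and the KERNEL `A(ẏ, k̇) = ∫_T β(y s k⁻¹) dνT` (well defined by left invariance of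
`νT` and ★ α2); `A` is jointly CONTINUOUS (dominated convergence on a uniform compact support, descended along the open quotient map
`mk × mk`), non-negative, and of unit mass `∫_{M⧸T′} A(ẏ, ·) = ∫_M β(y m⁻¹) dνM = ∫_M β(y m) dνM = 1` where `F(ẏ) ≠ 0` (transport `T′ → T`,
inversion invariance of `νT′` and `νM`, Weil on `M ⊇ T′` ★ `integral_fiberIntegral_quotientMeasure`, the cut-off identity); the Fubini step
★ `integral_integral_mul_kernel_eq_integral` integrates the kernel away: `= ∫_{G⧸T} F = Φ^G(t, ψ)`.  NO constant survives.

* `continuous_integral_mul_coe_mul_inv` — joint continuity of `(y, k) ↦ ∫_T β(y s k⁻¹) dνT`;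
* `integral_comp_coe_mul_left_eq` — left `T`-invariance of the kernel in `y`;
* **`orbitalIntegral_eq_orbitalIntegral_descended`**.

CONSUMER: the `hD` binder (DESCENT at `ε`) of ★ `Rogawski1990.exists_nhds_stableOrbitalIntegralRel_eq_of_central_singular_inv` (p841647; line «N6nsGerm»,
stub `stub_N6nsS1`), through the CM dress (next file).

## References
* [HarishChandra1970] Harish-Chandra (notes by G. van Dijk), *Harmonic Analysis on Reductive p-adic Groups*, LNM 162 (1970), Part I §3, Lemmas 19–23.
* [LanglandsShelstad1990Descent] R. P. Langlands, D. Shelstad, *Descent for transfer factors* (1990), §2.4.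
* [Rogawski1990] J. D. Rogawski, *Automorphic Representations of Unitary Groups in Three Variables* (1990), §8.2 p. 113.
* [Folland1995] G. B. Folland, *A Course in Abstract Harmonic Analysis* (1995), §2.6 Thm. 2.49 (Weil's formula).

## Provenance
Cell `hodgecm-mathlib`, seat A-p14 (g27), LEAD F0P3a-plan (g9) WORD T8-98∕T8-104 (co-hand of F0P3a-p08 (g13) on binder `hD`: M3 = the identity assembled).
HC_CM is proved only modulo the printed citations until rung 0 closes; this file proves no letter.
-/

set_option autoImplicit false

noncomputable section

open MeasureTheory MeasureTheory.Measure Topology Set Filter Function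
open scoped Pointwise NNReal ENNReal

namespace Literature.MeasureTheory.Group

-- the quotients carry the Borel σ-algebras supplied by the caller as binders (as in ★ `OrbitalDescentWeilStep`); no attribute is touched

section Kernel

variable {G : Type*} [Group G] [TopologicalSpace G] [IsTopologicalGroup G] [LocallyCompactSpace G] [FirstCountableTopology G]
  [T2Space G] (T : Subgroup G) [MeasurableSpace T] [BorelSpace T] (νT : Measure T)

/-- **Joint continuity of the kernel** `(y, k) ↦ ∫_T β(y s k⁻¹) dνT(s)` on `G × G` for `β ∈ C_c(G)`, `T` closed and `νT` finite on compacts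
(dominated convergence: for `(y, k)` in a compact neighbourhood `C₁ × C₂` the integrands are supported in the compact `T ∩ C₁⁻¹·supp β·C₂` and bounded
by `max |β|`). [cite: HarishChandra1970, Part I §3 Lemma 22] -/
theorem continuous_integral_mul_coe_mul_inv (hT : IsClosed (T : Set G)) [IsFiniteMeasureOnCompacts νT] {β : G → ℝ} (hβc : Continuous β)
    (hβs : HasCompactSupport β) : Continuous fun p : G × G => ∫ s : T, β (p.1 * (s : G) * p.2⁻¹) ∂νT := by
  refine continuous_iff_continuousAt.2 fun p₀ => ?_
  obtain ⟨C₁, hC₁c, hC₁n⟩ := exists_compact_mem_nhds p₀.1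
  obtain ⟨C₂, hC₂c, hC₂n⟩ := exists_compact_mem_nhds p₀.2
  -- the uniform compact support of the integrands
  set K : Set G := C₁⁻¹ * tsupport β * C₂ with hK
  have hKc : IsCompact K := (hC₁c.inv.mul hβs.isCompact).mul hC₂c
  set S : Set T := ((↑) : T → G) ⁻¹' K with hS
  have hSc : IsCompact S := (hT.isClosedEmbedding_subtypeVal).isCompact_preimage hKc
  obtain ⟨B, hB⟩ := hβc.norm.bddAbove_range_of_hasCompactSupport hβs.norm
  have hB' : ∀ x, ‖β x‖ ≤ B := fun x => hB ⟨x, rfl⟩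
  have hF : ∀ p : G × G, Continuous fun s : T => β (p.1 * (s : G) * p.2⁻¹) := fun p =>
    hβc.comp ((continuous_const.mul continuous_subtype_val).mul continuous_const)
  refine continuousAt_of_dominated (μ := νT) (bound := S.indicator fun _ => B) ?_ ?_ ?_ ?_
  · exact Eventually.of_forall fun p => (hF p).aestronglyMeasurable
  · have hn : C₁ ×ˢ C₂ ∈ 𝓝 p₀ := prod_mem_nhds hC₁n hC₂n
    filter_upwards [hn] with p hp
    refine Eventually.of_forall fun s => ?_
    by_cases hs : s ∈ S
    · rw [indicator_of_mem hs]; exact hB' _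
    · rw [indicator_of_notMem hs]
      have h0 : β (p.1 * (s : G) * p.2⁻¹) = 0 := by
        by_contra hne
        apply hs
        have hmem : p.1 * (s : G) * p.2⁻¹ ∈ tsupport β := subset_tsupport _ hne
        refine ⟨p.1⁻¹ * (p.1 * (s : G) * p.2⁻¹), Set.mul_mem_mul (Set.inv_mem_inv.2 hp.1) hmem, p.2, hp.2, ?_⟩
        simp [mul_assoc]
      rw [h0, norm_zero]
  · exact (integrable_indicator_iff hSc.measurableSet).2 ((integrableOn_const_iff).2 (Or.inr hSc.measure_lt_top))
  · refine Eventually.of_forall fun s => ?_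
    exact (hβc.comp ((continuous_fst.mul continuous_const).mul continuous_snd.inv)).continuousAt

omit [TopologicalSpace G] [IsTopologicalGroup G] [LocallyCompactSpace G] [FirstCountableTopology G] [T2Space G] [BorelSpace ↥T] in
/-- **Left `T`-invariance of the kernel in `y`**: `∫_T β(y s₀ s k⁻¹) dνT(s) = ∫_T β(y s k⁻¹) dνT(s)` for `s₀ ∈ T` (left invariance of `νT`).
[cite: HarishChandra1970, Part I §3 Lemma 22] -/
theorem integral_comp_coe_mul_left_eq [MeasurableMul T] [νT.IsMulLeftInvariant] (β : G → ℝ) (y k : G) (s₀ : T) :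
    ∫ s : T, β (y * (s₀ : G) * (s : G) * k⁻¹) ∂νT = ∫ s : T, β (y * (s : G) * k⁻¹) ∂νT := by
  have h := integral_mul_left_eq_self (μ := νT) (fun s : T => β (y * (s : G) * k⁻¹)) s₀
  rw [← h]
  refine integral_congr_ae (Eventually.of_forall fun s => ?_)
  simp only [Subgroup.coe_mul, mul_assoc]

end Kernel

section Descent

variable {G : Type*} [Group G] [TopologicalSpace G] [IsTopologicalGroup G] [LocallyCompactSpace G] [SecondCountableTopology G]
  [T2Space G] [MeasurableSpace G] [BorelSpace G]

/-- **Harish-Chandra's descent of orbital integrals** (module docstring): for `t ∈ M ≤ G` with centralisers `T = Z_G(t)`, `T′ = Z_M(t)`, matched Haar measures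
`νT = incl_* νT′`, canonical quotient measures `ν∕νT`, `νM∕νT′`, a cut-off `β` of unit `M`-mass on `C·M` and `ψ ∈ C_c(G)` compact modulo `M` at `t`,
`Φ^G(t, ψ; ν∕νT) = Φ^M(t, ψ_M; νM∕νT′)` with `ψ_M(m) = ∫_G β(x) • ψ(x m x⁻¹) dν(x)`.
[cite: HarishChandra1970, Part I §3 Lemmas 22–23] [cite: Rogawski1990, §8.2 p. 113] [cite: Folland1995, §2.6 Thm. 2.49] -/
theorem orbitalIntegral_eq_orbitalIntegral_descended
    (ν : Measure G) [ν.IsHaarMeasure] [ν.IsMulRightInvariant]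
    (M : Subgroup G) (hM : IsClosed (M : Set G))
    (νM : Measure M) [νM.IsHaarMeasure] [νM.IsMulRightInvariant] [νM.IsInvInvariant]
    (t : M)
    [hT : IsClosed ((Subgroup.centralizer ({(t : G)} : Set G) : Subgroup G) : Set G)]
    [hT' : IsClosed ((Subgroup.centralizer ({t} : Set M) : Subgroup M) : Set M)]
    [MeasurableSpace (G ⧸ Subgroup.centralizer ({(t : G)} : Set G))] [BorelSpace (G ⧸ Subgroup.centralizer ({(t : G)} : Set G))]
    [MeasurableSpace (M ⧸ Subgroup.centralizer ({t} : Set M))] [BorelSpace (M ⧸ Subgroup.centralizer ({t} : Set M))]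
    (νT : Measure (Subgroup.centralizer ({(t : G)} : Set G))) [νT.IsHaarMeasure] [νT.IsMulRightInvariant] [νT.IsInvInvariant]
    (νT' : Measure (Subgroup.centralizer ({t} : Set M))) [νT'.IsHaarMeasure] [νT'.IsInvInvariant]
    (hνT : νT = Measure.map (fun s : Subgroup.centralizer ({t} : Set M) =>
      (⟨((s : M) : G), Subgroup.mem_centralizer_singleton_iff.2 (by
        have h := Subgroup.mem_centralizer_singleton_iff.1 s.2
        exact_mod_cast congrArg ((↑) : M → G) h)⟩ : Subgroup.centralizer ({(t : G)} : Set G))) νT')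
    (hO : IsClosed {g : G | ∃ y : G, y * (t : G) * y⁻¹ = g})
    {C : Set G} {β : G → ℝ} (hβc : Continuous β) (hβs : HasCompactSupport β) (hβ0 : ∀ g, 0 ≤ β g)
    (hβ1 : ∀ c ∈ C, ∀ k₀ : M, ∫ h : M, β (c * (k₀ : G) * (h : G)) ∂νM = 1)
    {ψ : G → ℂ} (hψc : Continuous ψ) (hψs : HasCompactSupport ψ)
    (hCM : ∀ y : G, y * (t : G) * y⁻¹ ∈ tsupport ψ → y ∈ C * (M : Set G)) :
    Literature.NumberTheory.Automorphic.orbitalIntegral (t : G) ψ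
        (quotientMeasure (Subgroup.centralizer ({(t : G)} : Set G)) νT hT ν) =
      Literature.NumberTheory.Automorphic.orbitalIntegral t (fun m : M => ∫ x, β x • ψ (x * (m : G) * x⁻¹) ∂ν)
        (quotientMeasure (Subgroup.centralizer ({t} : Set M)) νT' hT' νM) := by
  classical
  have htT : ∀ s ∈ (Subgroup.centralizer ({(t : G)} : Set G)), s * (t : G) = (t : G) * s := fun s hs => Subgroup.mem_centralizer_singleton_iff.1 hs
  have htT' : ∀ s ∈ (Subgroup.centralizer ({t} : Set M)), s * t = t * s := fun s hs => Subgroup.mem_centralizer_singleton_iff.1 hs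
  -- the integrand on the `G`-side
  set F : G ⧸ (Subgroup.centralizer ({(t : G)} : Set G)) → ℂ := descConj (t : G) (Subgroup.centralizer ({(t : G)} : Set G)) htT ψ with hFdef
  have hFint : Integrable F (quotientMeasure (Subgroup.centralizer ({(t : G)} : Set G)) νT hT ν) := integrable_descConj_of_isClosed (t : G) hO hψc hψs (quotientMeasure (Subgroup.centralizer ({(t : G)} : Set G)) νT hT ν)
  /- (1) the kernel: `A2 (y, k) = ∫_T β(y s k⁻¹) dνT`, its descended version `A` and its properties -/
  set A2 : G × G → ℝ := fun p => ∫ s : (Subgroup.centralizer ({(t : G)} : Set G)), β (p.1 * (s : G) * p.2⁻¹) ∂νT with hA2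
  have hA2c : Continuous A2 := continuous_integral_mul_coe_mul_inv (Subgroup.centralizer ({(t : G)} : Set G)) νT hT hβc hβs
  -- invariances: left `(Subgroup.centralizer ({(t : G)} : Set G))` in `y`, right `(Subgroup.centralizer ({(t : G)} : Set G))′` in `k`
  have hA2y : ∀ (y k : G) (s₀ : (Subgroup.centralizer ({(t : G)} : Set G))), A2 (y * (s₀ : G), k) = A2 (y, k) := fun y k s₀ => by
    simp only [hA2]
    exact integral_comp_coe_mul_left_eq (Subgroup.centralizer ({(t : G)} : Set G)) νT β y k s₀
  have hA2k : ∀ (y : G) (k : M) (s₀ : (Subgroup.centralizer ({t} : Set M))), A2 (y, ((k * (s₀ : M) : M) : G)) = A2 (y, (k : G)) := fun y k s₀ => by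
    simp only [hA2, Subgroup.coe_mul]
    have hs₀ : ((s₀ : M) : G) ∈ (Subgroup.centralizer ({(t : G)} : Set G)) := by
      rw [Subgroup.mem_centralizer_singleton_iff]
      have h := htT' (s₀ : M) s₀.2
      exact_mod_cast congrArg ((↑) : M → G) h
    exact integral_comp_mul_coe_mul_inv_eq (Subgroup.centralizer ({(t : G)} : Set G)) νT β y (k : G) ⟨_, hs₀⟩
  -- the descended kernel
  set A : G ⧸ (Subgroup.centralizer ({(t : G)} : Set G)) → M ⧸ (Subgroup.centralizer ({t} : Set M)) → ℝ := fun yq kq => A2 (Quotient.out yq, ((Quotient.out kq : M) : G)) with hAdef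
  have hAmk : ∀ (y : G) (k : M), A (QuotientGroup.mk y) (QuotientGroup.mk k) = A2 (y, (k : G)) := by
    intro y k
    simp only [hAdef]
    -- representatives: `out (mk y) = y s₀`, `out (mk k) = k s₁`
    have hy : ∃ s₀ : (Subgroup.centralizer ({(t : G)} : Set G)), (Quotient.out (QuotientGroup.mk y : G ⧸ (Subgroup.centralizer ({(t : G)} : Set G))) : G) = y * (s₀ : G) := by
      have h := QuotientGroup.mk_out_eq_mul (Subgroup.centralizer ({(t : G)} : Set G)) y
      exact ⟨_, h.choose_spec⟩
    have hk : ∃ s₁ : (Subgroup.centralizer ({t} : Set M)), (Quotient.out (QuotientGroup.mk k : M ⧸ (Subgroup.centralizer ({t} : Set M))) : M) = k * (s₁ : M) := by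
      have h := QuotientGroup.mk_out_eq_mul (Subgroup.centralizer ({t} : Set M)) k
      exact ⟨_, h.choose_spec⟩
    obtain ⟨s₀, hs₀⟩ := hy
    obtain ⟨s₁, hs₁⟩ := hk
    rw [hs₀, hs₁, hA2y, hA2k]
  have hAcont : Continuous (uncurry A) := by
    have hq : IsOpenQuotientMap (Prod.map (QuotientGroup.mk : G → G ⧸ (Subgroup.centralizer ({(t : G)} : Set G))) (QuotientGroup.mk : M → M ⧸ (Subgroup.centralizer ({t} : Set M)))) :=
      (QuotientGroup.isOpenQuotientMap_mk (N := (Subgroup.centralizer ({(t : G)} : Set G)))).prodMap (QuotientGroup.isOpenQuotientMap_mk (N := (Subgroup.centralizer ({t} : Set M))))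
    rw [← hq.continuous_comp_iff]
    have heq : uncurry A ∘ Prod.map (QuotientGroup.mk : G → G ⧸ (Subgroup.centralizer ({(t : G)} : Set G))) (QuotientGroup.mk : M → M ⧸ (Subgroup.centralizer ({t} : Set M))) =
        fun p : G × M => A2 (p.1, (p.2 : G)) := by
      funext p; exact hAmk p.1 p.2
    rw [heq]
    exact hA2c.comp (continuous_fst.prodMk (continuous_subtype_val.comp continuous_snd))
  have hAmeas : Measurable (uncurry A) := hAcont.measurable
  have hA0 : ∀ yq kq, 0 ≤ A yq kq := fun yq kq => integral_nonneg fun s => hβ0 _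
  /- (2) unit mass: `∫_{M⧸(Subgroup.centralizer ({(t : G)} : Set G))′} A(ẏ, ·) = 1` whenever `F ẏ ≠ 0` -/
  have hA1 : ∀ yq : G ⧸ (Subgroup.centralizer ({(t : G)} : Set G)), F yq ≠ 0 → ∫ kq, A yq kq ∂(quotientMeasure (Subgroup.centralizer ({t} : Set M)) νT' hT' νM) = 1 := by
    intro yq hyq
    obtain ⟨y, rfl⟩ := QuotientGroup.mk_surjective yq
    -- `y ∈ C·M`
    have hy : y ∈ C * (M : Set G) := by
      apply hCM
      have h : ψ (y * (t : G) * y⁻¹) ≠ 0 := by rwa [hFdef, descConj_mk] at hyq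
      exact subset_tsupport _ h
    obtain ⟨c, hc, k₀, hk₀, rfl⟩ := hy
    -- the function `f(m) = β(y m⁻¹)` on `M`, compactly supported and continuous
    have hfc : Continuous fun m : M => β (c * k₀ * (m : G)⁻¹) := hβc.comp (continuous_const.mul continuous_subtype_val.inv)
    have hfs : HasCompactSupport fun m : M => β (c * k₀ * (m : G)⁻¹) := by
      have hKc : IsCompact (((c * k₀)⁻¹ • tsupport β)⁻¹ : Set G) := (hβs.isCompact.smul (c * k₀)⁻¹).inv
      refine HasCompactSupport.intro' ((hM.isClosedEmbedding_subtypeVal).isCompact_preimage hKc)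
        (((hM.isClosedEmbedding_subtypeVal).isCompact_preimage hKc).isClosed) fun m hm => ?_
      by_contra hne
      apply hm
      change (m : G) ∈ ((c * k₀)⁻¹ • tsupport β)⁻¹
      rw [Set.mem_inv, Set.mem_smul_set_iff_inv_smul_mem, inv_inv, smul_eq_mul]
      exact subset_tsupport _ hne
    set f : CompactlySupportedContinuousMap M ℝ := ⟨⟨fun m : M => β (c * k₀ * (m : G)⁻¹), hfc⟩, hfs⟩ with hfdef
    -- `A (mk y) (mk k) = fiberIntegral (Subgroup.centralizer ({(t : G)} : Set G))′ νT′ f (mk k)`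
    have hAf : ∀ k : M, A (QuotientGroup.mk (c * k₀)) (QuotientGroup.mk k) = fiberIntegral (Subgroup.centralizer ({t} : Set M)) νT' f (QuotientGroup.mk k) := by
      intro k
      rw [hAmk, fiberIntegral_mk]
      simp only [hA2]
      -- transport `νT = incl_* νT′`
      have hcont : Continuous fun s : (Subgroup.centralizer ({(t : G)} : Set G)) => β (c * k₀ * (s : G) * (k : G)⁻¹) :=
        hβc.comp ((continuous_const.mul continuous_subtype_val).mul continuous_const)
      have hφ : Continuous fun s : (Subgroup.centralizer ({t} : Set M)) => (⟨((s : M) : G), Subgroup.mem_centralizer_singleton_iff.2 (by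
          have h := Subgroup.mem_centralizer_singleton_iff.1 s.2
          exact_mod_cast congrArg ((↑) : M → G) h)⟩ : (Subgroup.centralizer ({(t : G)} : Set G))) :=
        Continuous.subtype_mk (continuous_subtype_val.comp continuous_subtype_val) _
      rw [hνT, integral_map hφ.aemeasurable hcont.aestronglyMeasurable]
      -- inversion invariance of `νT′` on the right-hand side
      have hinv : ∫ h : (Subgroup.centralizer ({t} : Set M)), (f : M → ℝ) (k * (h : M)) ∂νT' = ∫ h : (Subgroup.centralizer ({t} : Set M)), (f : M → ℝ) (k * ((h⁻¹ : (Subgroup.centralizer ({t} : Set M))) : M)) ∂νT' :=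
        (integral_inv_eq_self (fun h : (Subgroup.centralizer ({t} : Set M)) => (f : M → ℝ) (k * (h : M))) νT').symm
      rw [hinv]
      refine integral_congr_ae (Eventually.of_forall fun s => ?_)
      simp only [hfdef, CompactlySupportedContinuousMap.coe_mk, ContinuousMap.coe_mk, Subgroup.coe_mul, Subgroup.coe_inv, mul_inv_rev,
        inv_inv, mul_assoc]
    have hcongr : (fun kq => A (QuotientGroup.mk (c * k₀)) kq) = fun kq => fiberIntegral (Subgroup.centralizer ({t} : Set M)) νT' f kq := by
      funext kq
      obtain ⟨k, rfl⟩ := QuotientGroup.mk_surjective kq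
      exact hAf k
    rw [hcongr, integral_fiberIntegral_quotientMeasure]
    -- `∫_M β(c k₀ m⁻¹) dνM = ∫_M β(c k₀ m) dνM = 1`
    change ∫ m : M, β (c * k₀ * (m : G)⁻¹) ∂νM = 1
    have hinvM : ∫ m : M, β (c * k₀ * (m : G)⁻¹) ∂νM = ∫ m : M, β (c * k₀ * (m : G)) ∂νM := by
      have h := integral_inv_eq_self (fun m : M => β (c * k₀ * (m : G))) νM
      simp only [Subgroup.coe_inv] at h
      exact h
    rw [hinvM]
    exact hβ1 c hc ⟨k₀, hk₀⟩
  /- (3) the `M`-side integrand equals `∫_{G⧸(Subgroup.centralizer ({(t : G)} : Set G))} F · A(·, k̇)` -/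
  have hMside : ∀ k : M,
      descConj t (Subgroup.centralizer ({t} : Set M)) htT' (fun m : M => ∫ x, β x • ψ (x * (m : G) * x⁻¹) ∂ν) (QuotientGroup.mk k) =
        ∫ yq, F yq * (A yq (QuotientGroup.mk k) : ℂ) ∂(quotientMeasure (Subgroup.centralizer ({(t : G)} : Set G)) νT hT ν) := by
    intro k
    rw [descConj_mk]
    change ∫ x, β x • ψ (x * (((k * t * k⁻¹ : M)) : G) * x⁻¹) ∂ν = _
    have hcoe : (((k * t * k⁻¹ : M)) : G) = (k : G) * (t : G) * (k : G)⁻¹ := by simp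
    rw [hcoe, integral_smul_conj_conj_eq_integral_mul_right ν β ψ (t : G) (k : G)]
    -- real `•` on `ℂ` is multiplication by the real cast
    have hsm : (fun x => β (x * (k : G)⁻¹) • ψ (x * (t : G) * x⁻¹)) = fun x => (β (x * (k : G)⁻¹) : ℂ) * ψ (x * (t : G) * x⁻¹) := by
      funext x; rw [Complex.real_smul]
    rw [hsm]
    -- Weil on `G ⊇ (Subgroup.centralizer ({(t : G)} : Set G))` with constant `1`
    have hW := mul_integral_mul_descConj_eq_integral_fiberIntegralE_mul (Subgroup.centralizer ({(t : G)} : Set G)) νT (quotientMeasure (Subgroup.centralizer ({(t : G)} : Set G)) νT hT ν) ν (t : G) htT hβc hβs hψc (k : G)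
    rw [unfoldingConstant_quotientMeasure, NNReal.coe_one] at hW
    have hW' : ∫ x, (β (x * (k : G)⁻¹) : ℂ) * ψ (x * (t : G) * x⁻¹) ∂ν =
        ∫ y, fiberIntegralE (Subgroup.centralizer ({(t : G)} : Set G)) νT (fun x => (β (x * (k : G)⁻¹) : ℂ)) y * descConj (t : G) (Subgroup.centralizer ({(t : G)} : Set G)) htT ψ y ∂(quotientMeasure (Subgroup.centralizer ({(t : G)} : Set G)) νT hT ν) := by
      rw [← hW]; push_cast; ring
    rw [hW']
    refine integral_congr_ae (Eventually.of_forall fun yq => ?_)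
    obtain ⟨y, rfl⟩ := QuotientGroup.mk_surjective yq
    dsimp only
    rw [fiberIntegralE_mk, hAmk, integral_complex_ofReal, mul_comm]
  /- (4) assembly: Fubini with the unit-mass kernel -/
  rw [Literature.NumberTheory.Automorphic.orbitalIntegral_eq_integral_descConj,
    Literature.NumberTheory.Automorphic.orbitalIntegral_eq_integral_descConj]
  change ∫ yq, F yq ∂(quotientMeasure (Subgroup.centralizer ({(t : G)} : Set G)) νT hT ν) = ∫ kq, descConj t (Subgroup.centralizer ({t} : Set M)) htT' (fun m : M => ∫ x, β x • ψ (x * (m : G) * x⁻¹) ∂ν) kq ∂(quotientMeasure (Subgroup.centralizer ({t} : Set M)) νT' hT' νM)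
  have hcongr : (fun kq => descConj t (Subgroup.centralizer ({t} : Set M)) htT' (fun m : M => ∫ x, β x • ψ (x * (m : G) * x⁻¹) ∂ν) kq) =
      fun kq => ∫ yq, F yq * (A yq kq : ℂ) ∂(quotientMeasure (Subgroup.centralizer ({(t : G)} : Set G)) νT hT ν) := by
    funext kq
    obtain ⟨k, rfl⟩ := QuotientGroup.mk_surjective kq
    exact hMside k
  rw [hcongr, integral_integral_mul_kernel_eq_integral (quotientMeasure (Subgroup.centralizer ({(t : G)} : Set G)) νT hT ν) (quotientMeasure (Subgroup.centralizer ({t} : Set M)) νT' hT' νM) hFint hAmeas hA0 hA1]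

end Descent

end Literature.MeasureTheory.Group

end
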